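import Literature.NumberTheory.LFunctions.DeuringHeilbronn
import HarnessLib

/-!
# The Deuring–Heilbronn power-sum argument, abstract form: four weighted node families ("slots")

Topic `Literature/NumberTheory/LFunctions` (namespace `Literature.NumberTheory.LFunctions`).  Everything here is
PROVED; `DHSlot` is a structure (the data of one `L`-function in the argument) and `dh_of_slots` the theorem.

This file isolates the ANALYTIC SKELETON of the proof of the Deuring–Heilbronn phenomenon in the pair form of
Lagarias–Montgomery–Odlyzko / Thorner–Zaman [cite: ThornerZaman2017, §7.2 (7.7)–(7.13)]
[cite: LagariasMontgomeryOdlyzko1979, §4], exactly as carried out for class group characters in the tree's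
`DeuringHeilbronn.deuringHeilbronn`, so that it can be fed with other families of `L`-functions (here: the Hecke
`L`-functions of a congruence class group `mod 𝔪`).  A *slot* at the point `p` (`= 2` or `2 + it`) with
exceptional point `β` is a weighted node family `(w_i, ω_i)_i` (weights `≥ 0`, `= 0` or `≥ 1`) together with
numbers `a, e ∈ [0, 2]`, complex "Dirichlet sides" `P(μ)` and a bound `B`, such that for every `μ ≥ 1`

  `Σ_i w_i (p − ω_i)^{−2μ} = a (p − 1)^{−2μ} − e (p − β)^{−2μ} − P(μ)`,   `Σ_i w_i |p − ω_i|^{−2} ≤ B`.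

**Theorem** (`dh_of_slots`).  Given slots `S₀, S₁` at `pσ` and `S₂, S₃` at `ps` (`Re pσ = Re ps = 2`) with the same real
`β = β₁ ∈ (1/2, 1)`, balanced in pairs (`a₀ + a₁ = e₀ + e₁`, `a₂ + a₃ = e₂ + e₃`), with
`Re(P₀ + P₁ + P₂ + P₃)(μ) ≥ 0` for all `μ ≥ 1`, `B₀ + B₁ + B₂ + B₃ ≤ B`, `B ≥ 1`, and a node `ω` of `S₂` of
positive weight with `ps − ω = 1 + x`, `0 ≤ x ≤ 1/2`, one has

  `log(1/(C B (1 − β₁))) / (C B) ≤ x`,   `C = 49608`.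

Proof: the node sum of the family has real part `≤ 16 m (1 − β₁)` (`re_inv_pow_sub_inv_pow_le`), the one-sided
power sum inequality (`PowerSum.exists_re_tsum_powerSum_ge`, `ε = 1`) gives an `m ≤ 13M` with real part
`≥ b z₀^m/106 ≥ e^{−2mx}/106`, `M ≤ (9/4)B`, and `dh_final_step` concludes.

## References
* J. Thorner, A. Zaman, Algebra Number Theory 11 (2017), §7.2. [ThornerZaman2017]
* J. C. Lagarias, H. L. Montgomery, A. M. Odlyzko, Invent. Math. 54 (1979), §4. [LagariasMontgomeryOdlyzko1979]
-/

noncomputable section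

open Complex Filter Topology Set

namespace Literature.NumberTheory.LFunctions

open Literature.NumberTheory.LFunctions.NumberField Literature.NumberTheory.LFunctions.NumberField.DH
  Literature.Analysis.Complex

universe u

/-- **One slot of the Deuring–Heilbronn family**: a weighted node family at the point `pt` with exceptional
point `β`, pole coefficient `a`, removed exceptional multiplicity `e`, Dirichlet sides `P(μ)` and `M`-bound `B`.
[cite: ThornerZaman2017, §7.2 (7.7)–(7.8)] -/
structure DHSlot (pt β : ℂ) : Type (u + 1) where
  /-- the index type of the nodes -/
  ι : Type u
  /-- the weights -/
  w : ι → ℝ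
  /-- the nodes -/
  ω : ι → ℂ
  /-- the coefficient of the pole term `(pt − 1)^{−2μ}` -/
  a : ℝ
  /-- the multiplicity of the removed exceptional zero `β` -/
  e : ℝ
  /-- the Dirichlet side at exponent `μ` -/
  P : ℕ → ℂ
  /-- the bound for `Σ w |pt − ω|^{−2}` -/
  B : ℝ
  w_nonneg : ∀ i, 0 ≤ w i
  one_le_w : ∀ i, 0 < w i → 1 ≤ w i
  a_nonneg : 0 ≤ a
  a_le : a ≤ 2
  e_nonneg : 0 ≤ e
  e_le : e ≤ 2
  hasSum : ∀ μ : ℕ, 1 ≤ μ → HasSum (fun i ↦ (w i : ℂ) * (((pt - ω i) ^ 2)⁻¹) ^ μ)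
    (a * ((pt - 1) ^ (2 * μ))⁻¹ - e * ((pt - β) ^ (2 * μ))⁻¹ - P μ)
  summable : Summable fun i ↦ w i * ‖((pt - ω i) ^ 2)⁻¹‖
  tsum_le : ∑' i, w i * ‖((pt - ω i) ^ 2)⁻¹‖ ≤ B

namespace DHSlot

variable {β : ℝ} {t : ℝ}

/-- The real part of a pair value: `Re[c(A − A') − P] = c Re(A − A') − Re P`. [folklore] -/
private theorem re_pairValue (c : ℝ) (A A' P : ℂ) :
    ((c : ℂ) * (A - A') - P).re = c * (A - A').re - P.re := by
  rw [sub_re, Complex.re_ofReal_mul]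

/-- **The Deuring–Heilbronn power-sum argument for four slots.** [cite: ThornerZaman2017, §7.2 (7.7)–(7.13)]
[cite: LagariasMontgomeryOdlyzko1979, §4] -/
theorem dh_of_slots (hβ : 1 / 2 < β) (hβ1 : β < 1) {pσ ps : ℂ} (hpσre : pσ.re = 2) (hpsre : ps.re = 2)
    (S₀ S₁ : DHSlot.{u} pσ β) (S₂ S₃ : DHSlot.{u} ps β)
    (hbal₁ : S₀.a + S₁.a = S₀.e + S₁.e) (hbal₂ : S₂.a + S₃.a = S₂.e + S₃.e)
    (hpos : ∀ μ : ℕ, 1 ≤ μ → 0 ≤ (S₀.P μ + S₁.P μ + S₂.P μ + S₃.P μ).re)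
    {Btot : ℝ} (hB1 : 1 ≤ Btot) (hBtot : S₀.B + S₁.B + S₂.B + S₃.B ≤ Btot)
    {x : ℝ} (hx0 : 0 ≤ x) (hx : x ≤ 1 / 2) (i₂ : S₂.ι) (hi₂ : 0 < S₂.w i₂)
    (hω : ps - S₂.ω i₂ = ((1 + x : ℝ) : ℂ)) :
    Real.log (1 / (49608 * Btot * (1 - β))) / (49608 * Btot) ≤ x := by
  set δ₁ : ℝ := 1 - β with hδ₁
  have hδ₁0 : 0 < δ₁ := by rw [hδ₁]; linarith
  set C : ℝ := 49608 * Btot with hC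
  have hC0 : 0 < C := by positivity
  -- the family
  let J := (S₀.ι ⊕ S₁.ι) ⊕ (S₂.ι ⊕ S₃.ι)
  let b : J → ℝ := Sum.elim (Sum.elim S₀.w S₁.w) (Sum.elim S₂.w S₃.w)
  let z : J → ℂ := Sum.elim (Sum.elim (fun i ↦ ((pσ - S₀.ω i) ^ 2)⁻¹) (fun i ↦ ((pσ - S₁.ω i) ^ 2)⁻¹))
    (Sum.elim (fun i ↦ ((ps - S₂.ω i) ^ 2)⁻¹) (fun i ↦ ((ps - S₃.ω i) ^ 2)⁻¹))
  have hb0 : ∀ j, 0 ≤ b j := by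
    rintro ((i | i) | (i | i))
    exacts [S₀.w_nonneg i, S₁.w_nonneg i, S₂.w_nonneg i, S₃.w_nonneg i]
  have hb1 : ∀ j, 0 < b j → 1 ≤ b j := by
    rintro ((i | i) | (i | i)) h
    exacts [S₀.one_le_w i h, S₁.one_le_w i h, S₂.one_le_w i h, S₃.one_le_w i h]
  -- summability and the `M`-bound
  have hHS : HasSum (fun j ↦ b j * ‖z j‖)
      ((∑' i, S₀.w i * ‖((pσ - S₀.ω i) ^ 2)⁻¹‖ + ∑' i, S₁.w i * ‖((pσ - S₁.ω i) ^ 2)⁻¹‖) +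
        (∑' i, S₂.w i * ‖((ps - S₂.ω i) ^ 2)⁻¹‖ + ∑' i, S₃.w i * ‖((ps - S₃.ω i) ^ 2)⁻¹‖)) :=
    HasSum.sum (HasSum.sum (S₀.summable.hasSum.congr_fun fun i ↦ rfl) (S₁.summable.hasSum.congr_fun fun i ↦ rfl))
      (HasSum.sum (S₂.summable.hasSum.congr_fun fun i ↦ rfl) (S₃.summable.hasSum.congr_fun fun i ↦ rfl))
  have hsum : Summable fun j ↦ b j * ‖z j‖ := hHS.summable
  have hStot : ∑' j, b j * ‖z j‖ ≤ Btot := by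
    rw [hHS.tsum_eq]
    linarith [S₀.tsum_le, S₁.tsum_le, S₂.tsum_le, S₃.tsum_le]
  -- the value of the node sum at exponent `μ`
  have hval : ∀ μ : ℕ, 1 ≤ μ → HasSum (fun j ↦ (b j : ℂ) * z j ^ μ)
      (((S₀.a + S₁.a : ℝ) : ℂ) * (((pσ - 1) ^ (2 * μ))⁻¹ - ((pσ - β) ^ (2 * μ))⁻¹) - (S₀.P μ + S₁.P μ) +
        ((((S₂.a + S₃.a : ℝ) : ℂ) * (((ps - 1) ^ (2 * μ))⁻¹ - ((ps - β) ^ (2 * μ))⁻¹) - (S₂.P μ + S₃.P μ)))) := by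
    intro μ hμ
    have h0 := S₀.hasSum μ hμ; have h1 := S₁.hasSum μ hμ; have h2 := S₂.hasSum μ hμ; have h3 := S₃.hasSum μ hμ
    have hL := HasSum.sum (f := fun j : S₀.ι ⊕ S₁.ι ↦ ((Sum.elim S₀.w S₁.w j : ℝ) : ℂ) *
      (Sum.elim (fun i ↦ ((pσ - S₀.ω i) ^ 2)⁻¹) (fun i ↦ ((pσ - S₁.ω i) ^ 2)⁻¹) j) ^ μ)
      (h0.congr_fun fun i ↦ rfl) (h1.congr_fun fun i ↦ rfl)
    have hR := HasSum.sum (f := fun j : S₂.ι ⊕ S₃.ι ↦ ((Sum.elim S₂.w S₃.w j : ℝ) : ℂ) *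
      (Sum.elim (fun i ↦ ((ps - S₂.ω i) ^ 2)⁻¹) (fun i ↦ ((ps - S₃.ω i) ^ 2)⁻¹) j) ^ μ)
      (h2.congr_fun fun i ↦ rfl) (h3.congr_fun fun i ↦ rfl)
    have hall := HasSum.sum (f := fun j : J ↦ (b j : ℂ) * z j ^ μ)
      (hL.congr_fun fun j ↦ by rcases j with i | i <;> rfl) (hR.congr_fun fun j ↦ by rcases j with i | i <;> rfl)
    convert hall using 1
    have e1 : ((S₀.e + S₁.e : ℝ) : ℂ) = ((S₀.a + S₁.a : ℝ) : ℂ) := by rw [hbal₁]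
    have e2 : ((S₂.e + S₃.e : ℝ) : ℂ) = ((S₂.a + S₃.a : ℝ) : ℂ) := by rw [hbal₂]
    push_cast at e1 e2 ⊢
    linear_combination ((pσ - ↑β) ^ (2 * μ))⁻¹ * e1 + ((ps - ↑β) ^ (2 * μ))⁻¹ * e2
  -- the node of `ρ`
  set j₁ : J := Sum.inr (Sum.inl i₂) with hj₁
  have hbj₁ : 0 < b j₁ := hi₂
  have h1x : 0 < 1 + x := by linarith
  have hzj₁norm : ‖z j₁‖ = ((1 + x) ^ 2)⁻¹ := by
    show ‖((ps - S₂.ω i₂) ^ 2)⁻¹‖ = ((1 + x) ^ 2)⁻¹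
    rw [hω, norm_inv, norm_pow, Complex.norm_real, Real.norm_of_nonneg h1x.le]
  have hzj₁0 : z j₁ ≠ 0 := by rw [← norm_pos_iff, hzj₁norm]; positivity
  -- the maximal node and the power sum inequality
  obtain ⟨j₀, hbj₀, hzj₀, hmax⟩ := PowerSum.exists_max_node z b hb1 hsum hbj₁ hzj₁0
  obtain ⟨m, hm1, hmM, hmain, -⟩ := PowerSum.exists_re_tsum_powerSum_ge z b hb0 hsum hbj₀ hzj₀ hmax one_pos
  rw [(hval m hm1).tsum_eq, add_re, re_pairValue, re_pairValue] at hmain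
  -- upper bound of the value: `≤ 16 m δ₁`
  have hPm := hpos m hm1
  have hc1 : (((pσ - 1) ^ (2 * m))⁻¹ - ((pσ - β) ^ (2 * m))⁻¹).re ≤ 2 * m * δ₁ := by
    have h := re_inv_pow_sub_inv_pow_le (a := pσ - 1) (by rw [sub_re, hpσre]; norm_num) hδ₁0.le (2 * m)
    have e : pσ - 1 + (δ₁ : ℂ) = pσ - β := by rw [hδ₁]; push_cast; ring
    rw [e] at h; push_cast at h; linarith
  have hc2 : (((ps - 1) ^ (2 * m))⁻¹ - ((ps - β) ^ (2 * m))⁻¹).re ≤ 2 * m * δ₁ := by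
    have h := re_inv_pow_sub_inv_pow_le (a := ps - 1) (by rw [sub_re, hpsre]; norm_num) hδ₁0.le (2 * m)
    have e : ps - 1 + (δ₁ : ℂ) = ps - β := by rw [hδ₁]; push_cast; ring
    rw [e] at h; push_cast at h; linarith
  have hupper : (1 : ℝ) / (96 + 10 * 1) * b j₀ * ‖z j₀‖ ^ m ≤ 16 * m * δ₁ := by
    have hmδ : 0 ≤ 2 * (m : ℝ) * δ₁ := by positivity
    have w1 := mul_le_mul_of_nonneg_left hc1 (by linarith [S₀.a_nonneg, S₁.a_nonneg] : (0:ℝ) ≤ S₀.a + S₁.a)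
    have w2 := mul_le_mul_of_nonneg_left hc2 (by linarith [S₂.a_nonneg, S₃.a_nonneg] : (0:ℝ) ≤ S₂.a + S₃.a)
    have w3 : (S₀.a + S₁.a) * (2 * m * δ₁) ≤ 4 * (2 * m * δ₁) :=
      mul_le_mul_of_nonneg_right (by linarith [S₀.a_le, S₁.a_le]) hmδ
    have w4 : (S₂.a + S₃.a) * (2 * m * δ₁) ≤ 4 * (2 * m * δ₁) :=
      mul_le_mul_of_nonneg_right (by linarith [S₂.a_le, S₃.a_le]) hmδ
    have a1 := add_re (S₀.P m) (S₁.P m)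
    have a2 := add_re (S₂.P m) (S₃.P m)
    have a3 := add_re (S₀.P m + S₁.P m) (S₂.P m)
    have a4 := add_re (S₀.P m + S₁.P m + S₂.P m) (S₃.P m)
    linarith
  -- lower bound: `b j₀ ‖z j₀‖^m ≥ ‖z j₁‖^m ≥ exp(−2 m x)`
  have hzle : ‖z j₁‖ ≤ ‖z j₀‖ := hmax j₁ hbj₁
  have hlow : Real.exp (-(2 * m * x)) ≤ b j₀ * ‖z j₀‖ ^ m := by
    calc Real.exp (-(2 * m * x)) ≤ ‖z j₁‖ ^ m := by rw [hzj₁norm]; exact exp_neg_le_inv_sq_pow hx0 m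
      _ ≤ ‖z j₀‖ ^ m := pow_le_pow_left₀ (norm_nonneg _) hzle m
      _ = 1 * ‖z j₀‖ ^ m := (one_mul _).symm
      _ ≤ b j₀ * ‖z j₀‖ ^ m := mul_le_mul_of_nonneg_right (hb1 j₀ hbj₀) (by positivity)
  -- the quantity `M`
  set S : ℝ := ∑' j, b j * ‖z j‖ with hS
  have hbz₀ : 0 < b j₀ * ‖z j₀‖ := mul_pos hbj₀ (norm_pos_iff.mpr hzj₀)
  set M : ℝ := S / (b j₀ * ‖z j₀‖) with hM
  have hS₀ : b j₀ * ‖z j₀‖ ≤ S := hsum.le_tsum j₀ (fun j _ ↦ mul_nonneg (hb0 j) (norm_nonneg _))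
  have hM1 : 1 ≤ M := by rw [hM, le_div_iff₀ hbz₀, one_mul]; exact hS₀
  have hzj₁ge : (4 : ℝ) / 9 ≤ ‖z j₁‖ := by
    rw [hzj₁norm]
    have : (1 + x) ^ 2 ≤ 9 / 4 := by nlinarith
    calc (4 : ℝ) / 9 = (9 / 4 : ℝ)⁻¹ := by norm_num
      _ ≤ ((1 + x) ^ 2)⁻¹ := inv_anti₀ (by positivity) this
  have hbz₀ge : (4 : ℝ) / 9 ≤ b j₀ * ‖z j₀‖ := by
    calc (4 : ℝ) / 9 ≤ ‖z j₁‖ := hzj₁ge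
      _ ≤ ‖z j₀‖ := hzle
      _ = 1 * ‖z j₀‖ := (one_mul _).symm
      _ ≤ b j₀ * ‖z j₀‖ := mul_le_mul_of_nonneg_right (hb1 j₀ hbj₀) (norm_nonneg _)
  set M₁ : ℝ := 9 / 4 * Btot with hM₁
  have hMM₁ : M ≤ M₁ := by
    rw [hM, hM₁, div_le_iff₀ hbz₀]
    have h1 := mul_le_mul_of_nonneg_left hbz₀ge (by linarith : (0 : ℝ) ≤ Btot)
    linarith only [hStot, h1]
  -- combine
  have hm13 : (m : ℝ) ≤ 13 * M := by linarith only [hmM]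
  have hkey : Real.exp (-(26 * M * x)) ≤ 22048 * M * δ₁ := by
    have e1 : Real.exp (-(26 * M * x)) ≤ Real.exp (-(2 * m * x)) := by
      apply Real.exp_le_exp.mpr
      have h2m : 2 * (m : ℝ) ≤ 26 * M := by linarith only [hm13]
      have := mul_le_mul_of_nonneg_right h2m hx0
      linarith only [this]
    have e2 : Real.exp (-(2 * m * x)) ≤ 106 * (16 * m * δ₁) := by
      have h106 : (1 : ℝ) / (96 + 10 * 1) * b j₀ * ‖z j₀‖ ^ m = (b j₀ * ‖z j₀‖ ^ m) / 106 := by ring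
      rw [h106, div_le_iff₀ (by norm_num : (0:ℝ) < 106)] at hupper
      linarith only [hupper, hlow]
    have e3 : (106 : ℝ) * (16 * m * δ₁) ≤ 22048 * M * δ₁ := by
      have := mul_le_mul_of_nonneg_right hm13 hδ₁0.le
      linarith only [this]
    linarith only [e1, e2, e3]
  have hfinal := dh_final_step hx0 hM1 hMM₁ hδ₁0 (by norm_num : (0 : ℝ) < 22048) hkey
  have hCℒ : 22048 * M₁ = C := by rw [hM₁, hC]; ring
  rw [hCℒ] at hfinal
  by_cases hneg : Real.log (1 / (C * δ₁)) < 0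
  · exact (div_nonpos_of_nonpos_of_nonneg hneg.le hC0.le).trans hx0
  · push Not at hneg
    calc Real.log (1 / (C * δ₁)) / C ≤ Real.log (1 / (C * δ₁)) / (26 * M₁) := by
          apply div_le_div_of_nonneg_left hneg (by positivity)
          rw [hM₁, hC]; nlinarith
      _ ≤ x := hfinal

end DHSlot

end Literature.NumberTheory.LFunctions

end
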